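import Literature.AlgebraicGeometry.HodgeTheory.GlobalInvariantCycles
import HarnessLib

/-!
# Rank-one complex sub-local systems of `Rᵏ f_* ℂ` have finite monodromy (Deligne, *Théorie de Hodge II*, Cor. 4.2.8 (iii)(b)) — named fact

Family `hodge`, layer `Literature/AlgebraicGeometry/HodgeTheory`. NAMED FACT (D-0014), on the real carriers of
`HodgeTheory/HodgeLocus` (`complexBetti`, `Motives.fiberOver`, `IsContinuationAlong`) and the quasi-projectivity
predicate of `HodgeTheory/GlobalInvariantCycles`. Source, held and read (`paper:url-844aebd4b2c4`, pp. 44–48 of the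
journal pagination): P. Deligne, *Théorie de Hodge II*, Publ. Math. IHÉS 40 (1971), §4.2:

* Prop. 4.2.5 (iii): "Si `f : X → S` est propre et lisse, alors `R f_* ℚ` est algébrique" (Def. 4.2.4, `S` lisse
  et connexe), and (i): "La catégorie des familles continues algébriques de `ℚ`-structures de Hodge sur `S`
  vérifie les conditions de (4.2.2)";
* Thm. 4.2.6 (semi-simplicity) and **Cor. 4.2.8 (iii)**: "Soit `W` un sous-système local complexe de dimension `d`
  de `H_ℂ`: (a) … (b) [une puissance tensorielle] de `∧ᵈ W` est un système local trivial", whose printed proof for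
  a simple constituent of rank `d` ends (p. 48): "Pour `γ ∈ π₁(S, s)`, `χ(γ)` est un entier algébrique ayant au plus
  `N` conjugués complexes, et ceux-ci sont tous de valeur absolue `1`; `χ(γ)` est donc une racine `k`-ième de
  l'unité, avec `k ≤ N`. On a donc `χ^{N!} = 1`".

For `d = 1` this says: the character `χ` of `π₁(S(ℂ), s)` on a rank-one complex sub-local system
`W ⊂ Rᵏ f_* ℂ` takes values in the `N!`-th roots of unity; in particular every `w ∈ W_s` has finitely many
monodromy translates `χ(γ) w`. The rendering below is that consequence (orbit form, `ℂ`-coefficients as printed)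
for smooth projective families over smooth irreducible quasi-projective bases — weaker, never stronger, than the
printed corollary.

* `deligne1971_rankOne_subLocalSystem_finiteMonodromy` — the named fact.

Consumer: stub S2 `FiniteMonodromyOfRankLeOne` of crux `RigidUnwinding.UnwindingReduction` (Hodge summit;
`Summits/…/Theorems/RigidUnwindingUnwindingReductionFiniteMonodromyOfRankLeOne`). Not proved in the tree: it needs
the polarized variation of Hodge structure on `Rᵏ f_* ℚ` with its semisimplicity (Thm. 4.2.6, Lemma 4.2.7) and
the integrality / Galois-conjugation argument (Kronecker), none of which exists on the carriers.

## References

* [DeligneHodgeII1971] P. Deligne, Théorie de Hodge II, Publ. Math. IHÉS 40 (1971), Def. 4.2.4, Prop. 4.2.5,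
  Thm. 4.2.6, Cor. 4.2.8 (iii)(b) (pp. 44–48).
* [VoisinHodgeI2002] C. Voisin, Hodge Theory and Complex Algebraic Geometry I (2002), §9.2.1 (local systems,
  transport along paths).
-/

noncomputable section

open CategoryTheory AlgebraicGeometry
open _root_.Topology

namespace Literature.AlgebraicGeometry.HodgeTheory

/-- **Rank-one complex sub-local systems of `Rᵏ f_* ℂ` have finite monodromy** (Deligne, *Théorie de
Hodge II*, Cor. 4.2.8 (iii)(b), applied to the "algebraic" family `Rᵏ f_* ℚ` of a proper smooth `f` over a
smooth connected base, Prop. 4.2.5 (i), (iii)): "Soit `W` un sous-système local complexe de dimension `d` de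
`H_ℂ` … (b) [une puissance tensorielle] de `∧ᵈ W` est un système local trivial"; for `d = 1` the printed
proof (p. 48) gives `χ^{N!} = 1` for the character `χ` of `W` ("`χ(γ)` est un entier algébrique ayant au plus
`N` conjugués complexes, et ceux-ci sont tous de valeur absolue `1`; `χ(γ)` est donc une racine `k`-ième de
l'unité, avec `k ≤ N`"), so every vector of `W_s` has finitely many monodromy translates. ON THE CARRIERS
(`d = 1`, orbit form): for a smooth projective family `f : 𝒳 ⟶ S` of relative dimension `n`
(`Motives.IsSmoothProjectiveFamily`: proper, smooth, smooth projective fibres) over a smooth, irreducible,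
quasi-projective `ℂ`-scheme `S` ("`S` lisse connexe"), a degree `k`, and a family of LINES
`M_t ⊆ Hᵏ(𝒳_t(ℂ); ℂ)` (`finrank = 1`) stable under flat continuation along paths (`IsContinuationAlong`) — a
rank-one complex sub-local system of `Rᵏ f_* ℂ` —, every `α ∈ M_s` has only finitely many continuations
along loops at `s`. Named fact (D-0014); not proved in the tree (no polarized-VHS / semisimplicity package —
Thm. 4.2.6, Lemma 4.2.7 — for `Rᵏ f_* ℂ` on the carriers).
-- TODO(general form): dimension `d` (a tensor power of `∧ᵈ W` is trivial), the bound `χ^{N!} = 1` with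
-- `N = rk Rᵏ f_* ℚ`, and `S` smooth connected not necessarily quasi-projective.
[cite: DeligneHodgeII1971, Cor. 4.2.8 (iii)(b) (pp. 47–48) with Prop. 4.2.5 (i), (iii) (pp. 44–45)] -/
def deligne1971_rankOne_subLocalSystem_finiteMonodromy : Prop :=
  ∀ (𝒳 S : Motives.SchemeOver ℂ) (f : 𝒳 ⟶ S) (n : ℕ),
    Motives.IsSmoothProjectiveFamily f n → IsQuasiProjectiveOver S → AlgebraicGeometry.Smooth S.hom →
    IrreducibleSpace S.left →
    ∀ (k : ℕ) (M : ∀ t : Motives.ComplexPoints S, Submodule ℂ (complexBetti (Motives.fiberOver f t) k)),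
      (∀ t, Module.finrank ℂ (M t) = 1) →
      (∀ (s t : Motives.ComplexPoints S) (γ : Path s t) (α : complexBetti (Motives.fiberOver f s) k)
          (β : complexBetti (Motives.fiberOver f t) k), α ∈ M s → IsContinuationAlong γ α β → β ∈ M t) →
      ∀ (s : Motives.ComplexPoints S) (α : complexBetti (Motives.fiberOver f s) k), α ∈ M s →
        Set.Finite {β : complexBetti (Motives.fiberOver f s) k | ∃ γ : Path s s, IsContinuationAlong γ α β}

end Literature.AlgebraicGeometry.HodgeTheory

end
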